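import Summits.BirchSwinnertonDyer.BirchSwinnertonDyer.Theorems.GoldfeldAllTwistsTwoConverseTwinAdditiveTwoPrimesTwistSelmerDualThreeModEightPOne
import Summits.BirchSwinnertonDyer.BirchSwinnertonDyer.Theorems.GoldfeldAllTwistsTwoConverseTwinAdditiveTwoPrimesTwistSelmer
import Summits.BirchSwinnertonDyer.BirchSwinnertonDyer.Theorems.GoldfeldAllTwistsTwoConverseTwinAdditiveTwoAdicDualThreeModEightPFive
import HarnessLib

set_option linter.dupNamespace false -- namespace `…BirchSwinnertonDyer.BirchSwinnertonDyer…` is the cell's (D-0017 nested layout)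
set_option autoImplicit false

/-!
# B5⁺ tranche F_β⁺, file Fβ⁺-3: the SHARP dual Selmer set `S′ = S(84qp, −28q²p²) ⊆ {1, −7, 2p, −14p}` of `W = 49a1^{(−2qp)}` on the β cell
# `q ≡ 3 (8)`, `(q/7) = −1`; `p ≡ 5 (8)`, `(−7/p) = 1`, `−7 ∈ 𝔽_p^{×4}`; **`(p/q) = +1`** (cell b35+) — FACT-FREE; a NEW survivor set

Cell `bsd-goldfeld`, seat `bsd-goldfeld-s1p-c3x` (gen 16); planner ORDER (cccxciii) «OBJECT B5⁺», tranche F_β⁺ (kill table `scoping/kills_b35_plus.txt`, 41 rows: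
`S′(W) = {1, −7, 2p, −14p}` uniformly). TWIN of C5-F's F-S′ `…TwinAdditiveTwoPrimesTwistSelmerDualThreeModEightPOne` (`(3, 1, −)`, survivors `{1, −7, 2, −14}`)
with `hp8 : p % 8 = 1 ↦ 5`, `hpq = −1 ↦ +1`. The 32 classes `d ∣ 14qp` (quartic `d u⁴ + 84qp u²z² + d′ z⁴`, `d d′ = −28q²p²`) die as follows:
* at `7` (sixteen classes, VERBATIM): `qp, 2qp, −7qp, −14qp, −p, −2p, 7p, 14p, q, 2q, −7q, −14q, −1, −2, 7, 14`;
* at `p` by NON-RESIDUE (`(2/p) = −1` here, `(q/p) = (7/p) = (−1/p) = +1`): `2, −14, −2q, 14q` (the source: `−q, 7q, −2q, 14q` with `(q/p) = −1`);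
* at `p` by the TYPE-β ROOT TEST (`not_isSoluble_padic_typeBeta_class_dual`): `p, −7p` (non-residues `14q, −2q` as in the source) and NOW `−qp, 7qp`
  (non-residues `−14, 2`); the source's `2p, −14p` SURVIVE here (`7q`, `−q` are residues mod `p`);
* at `2` (Fβ⁺-0c): `−2qp, 14qp` (onto C7-F9a's `(−84; 2, −14)`) and `−q, 7q` (the new numerics `(1260; −3, 2100)`, `(1260; 21, −300)`);
and `1, −7, 2p, −14p` SURVIVE (`(#S, #S′) = (2, 4)` on b35+). `--supports stmt-BirchSwinnertonDyer-19140` as a HELPER. Theses-free; theorems only; no definition,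
no fact binder, no `sorry`. FRONTIER-grade: a twist-density-ZERO sub-family; never distance-to-summit.
HONEST FRAMING: a Selmer bound; no `BSD(W,2)` is proved; BSD is not proved by any of this; item 19140 stays open.

References: [SilvermanAEC2009] Prop. X.4.9, Example X.4.10; [Zywina2025] Lemma 3.1.
-/

noncomputable section

open scoped Classical

open WeierstrassCurve Literature.NumberTheory.EllipticCurves

namespace Summit.BirchSwinnertonDyer.BirchSwinnertonDyer.Theorems.GoldfeldGoodTwists

section SelmerDualThreeFivePlus
variable {q p : ℕ} [Fact q.Prime] [Fact p.Prime]

/-- A natural number not divisible by the prime `ℓ` is non-zero in `ZMod ℓ`, as an integer cast. [folklore] -/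
private theorem intCast_ne_zero_of_not_dvd_dualThreeFivePlus {l : ℕ} [Fact l.Prime] {n : ℕ} (h : ¬ l ∣ n) : ((n : ℤ) : ZMod l) ≠ 0 := by
  rw [Int.cast_natCast, Ne, ZMod.natCast_eq_zero_iff]; exact h

/-- A prime `ℓ ≠ 2, 7` divides no `2^a·7^b`. [folklore] -/
private theorem not_dvd_two_pow_mul_seven_pow_dualThreeFivePlus {l : ℕ} (hl : l.Prime) (hl2 : l ≠ 2) (hl7 : l ≠ 7) (a b : ℕ) :
    ¬ l ∣ 2 ^ a * 7 ^ b := by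
  intro h
  rcases (Nat.Prime.dvd_mul hl).mp h with h | h
  · exact hl2 ((Nat.prime_dvd_prime_iff_eq hl Nat.prime_two).mp (hl.dvd_of_dvd_pow h))
  · exact hl7 ((Nat.prime_dvd_prime_iff_eq hl (by norm_num)).mp (hl.dvd_of_dvd_pow h))

omit [Fact q.Prime] [Fact p.Prime] in
/-- `7 ∤ a`, `7 ∤ b` ⇒ `7 ∤ ab`. [folklore] -/
private theorem not_seven_dvd_mul_dualThreeFivePlus {a b : ℤ} (ha : ¬ (7 : ℤ) ∣ a) (hb : ¬ (7 : ℤ) ∣ b) : ¬ (7 : ℤ) ∣ a * b := fun h ↦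
  ((Int.prime_iff_natAbs_prime.mpr (by norm_num) : Prime (7 : ℤ)).dvd_or_dvd h).elim ha hb

/-- The cell's arithmetic facts used by both halves of the count. [folklore] -/
private theorem dual_facts_threeFivePlus (hq8 : q % 8 = 3) (hq7 : jacobiSym q 7 = -1) (hp8 : p % 8 = 5) (hp7 : legendreSym p (-7) = 1)
    (hpq : jacobiSym p q = 1) :
    (q ≠ p ∧ ¬ 7 ∣ q * p ∧ ¬ (7 : ℤ) ∣ q ∧ ¬ (7 : ℤ) ∣ p) ∧
    (legendreSym 7 q = -1 ∧ legendreSym 7 p = 1 ∧ ((q : ℤ) : ZMod 7) ≠ 0 ∧ ((p : ℤ) : ZMod 7) ≠ 0) ∧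
    (legendreSym p 2 = -1 ∧ legendreSym p 7 = 1 ∧ legendreSym p (-1) = 1 ∧ legendreSym p q = 1) ∧
    (((q : ℤ) : ZMod p) ≠ 0 ∧ ((2 : ℤ) : ZMod p) ≠ 0 ∧ ((28 : ℤ) : ZMod p) ≠ 0 ∧ (448 : ZMod p) ≠ 0 ∧ ((4 : ℤ) : ZMod p) ≠ 0) := by
  have hq : q.Prime := Fact.out
  have hp : p.Prime := Fact.out
  haveI : Fact (Nat.Prime 7) := ⟨by norm_num⟩
  have hq2 : q ≠ 2 := by rintro rfl; norm_num at hq8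
  have hp2 : p ≠ 2 := by rintro rfl; norm_num at hp8
  have hqp : q ≠ p := by rintro rfl; omega
  have hq7' : q ≠ 7 := by rintro rfl; rw [jacobiSym.mod_left] at hq7; norm_num at hq7
  have hp7' : p ≠ 7 := by rintro rfl; norm_num at hp8
  have h7Q : ¬ (7 : ℤ) ∣ q := fun h ↦ hq7' ((Nat.prime_dvd_prime_iff_eq (by norm_num) hq).mp (by exact_mod_cast h)).symm
  have h7P : ¬ (7 : ℤ) ∣ p := fun h ↦ hp7' ((Nat.prime_dvd_prime_iff_eq (by norm_num) hp).mp (by exact_mod_cast h)).symm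
  have h7qp : ¬ 7 ∣ q * p := fun h ↦ ((Nat.Prime.dvd_mul (by norm_num)).mp h).elim (fun h ↦ h7Q (by exact_mod_cast h))
    (fun h ↦ h7P (by exact_mod_cast h))
  obtain ⟨h2p, h7p, hm1p⟩ := legendreSym_two_seven_neg_one_of_five_mod_eight hp8 hp7
  -- `(q/p) = (p/q) = +1`
  have hqp_p : legendreSym p q = 1 := by
    have h := legendreSym.quadratic_reciprocity_one_mod_four (show p % 4 = 1 by omega) hq2
    have hpq' := hpq
    rw [← jacobiSym.legendreSym.to_jacobiSym] at hpq'
    rw [← h]; exact hpq'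
  have h7_q : legendreSym 7 q = -1 := by rw [jacobiSym.legendreSym.to_jacobiSym]; exact_mod_cast hq7
  have h7_p : legendreSym 7 p = 1 := by
    rw [legendreSym.quadratic_reciprocity_one_mod_four (by omega : p % 4 = 1) (by norm_num : 7 ≠ 2)]; exact h7p
  have hq07 : ((q : ℤ) : ZMod 7) ≠ 0 := by rw [Ne, ZMod.intCast_zmod_eq_zero_iff_dvd]; exact_mod_cast h7Q
  have hp07 : ((p : ℤ) : ZMod 7) ≠ 0 := by rw [Ne, ZMod.intCast_zmod_eq_zero_iff_dvd]; exact_mod_cast h7P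
  have hqp0 : ((q : ℤ) : ZMod p) ≠ 0 :=
    intCast_ne_zero_of_not_dvd_dualThreeFivePlus (l := p) (fun h ↦ hqp ((Nat.prime_dvd_prime_iff_eq hp hq).mp h).symm)
  have hcp : ∀ a b : ℕ, (((2 ^ a * 7 ^ b : ℕ) : ℤ) : ZMod p) ≠ 0 := fun a b ↦
    intCast_ne_zero_of_not_dvd_dualThreeFivePlus (not_dvd_two_pow_mul_seven_pow_dualThreeFivePlus hp hp2 hp7' a b)
  have h2p0 : ((2 : ℤ) : ZMod p) ≠ 0 := by have := hcp 1 0; norm_num at this; exact_mod_cast this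
  have h4p0 : ((4 : ℤ) : ZMod p) ≠ 0 := by have := hcp 2 0; norm_num at this; exact_mod_cast this
  have h28p0 : ((28 : ℤ) : ZMod p) ≠ 0 := by have := hcp 2 1; norm_num at this; exact_mod_cast this
  have h448p : (448 : ZMod p) ≠ 0 := by have := hcp 6 1; norm_num at this; exact_mod_cast this
  exact ⟨⟨hqp, h7qp, h7Q, h7P⟩, ⟨h7_q, h7_p, hq07, hp07⟩, ⟨h2p, h7p, hm1p, hqp_p⟩, ⟨hqp0, h2p0, h28p0, h448p, h4p0⟩⟩

set_option maxHeartbeats 400000 in -- sixteen `p`-classes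
/-- **§1. The classes of `S′ = S(84qp, −28q²p²)` divisible by `p` are among `2p, −14p`** on the β cell `q ≡ 3 (8)`, `p ≡ 5 (8)`, `(p/q) = +1`:
writing `d = p·e`, fourteen of the sixteen die — `qp, 2qp, −7qp, −14qp, −p, −2p, 7p, 14p` at `7`; `−2qp, 14qp` at `2` (Fβ⁺-0c); `p, −7p, −qp, 7qp`
at `p` by the type-β root test. [cite: SilvermanAEC2009, Prop. X.4.9 and Example X.4.10] -/
theorem eq_of_prime_dvd_of_mem_twoIsogenySelmerGroup'_twoPrimesTwist_threeModEightPlusPFive (hq8 : q % 8 = 3) (hq7 : jacobiSym q 7 = -1)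
    (hp8 : p % 8 = 5) (hp7 : legendreSym p (-7) = 1) (hβ : ∃ x : ZMod p, x ^ 4 = -7) (hpq : jacobiSym p q = 1)
    {d d' : ℤ} (hsqf : Squarefree d) (hdd' : -28 * ((q : ℤ) * p) ^ 2 = d * d')
    (hpadic : ∀ (l : ℕ) [Fact l.Prime], ((twoIsogenyQuartic (84 * ((q : ℤ) * p)) d d').map (Int.castRingHom ℚ_[l])).IsSoluble)
    (hpd : (p : ℤ) ∣ d) : d = 2 * p ∨ d = -14 * p := by
  obtain ⟨e, hde⟩ := hpd
  have hq : q.Prime := Fact.out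
  have hp : p.Prime := Fact.out
  haveI : Fact (Nat.Prime 7) := ⟨by norm_num⟩
  have hqZ : Prime (q : ℤ) := Nat.prime_iff_prime_int.mp hq
  have hq0 : (q : ℤ) ≠ 0 := by exact_mod_cast hq.ne_zero
  have hp0 : (p : ℤ) ≠ 0 := by exact_mod_cast hp.ne_zero
  obtain ⟨⟨hqp, h7qp, h7Q, h7P⟩, ⟨h7_q, h7_p, hq07, hp07⟩, ⟨h2p, h7p, hm1p, hqp_p⟩, ⟨hqp0, h2p0, h28p0, h448p, h4p0⟩⟩ :=
    dual_facts_threeFivePlus hq8 hq7 hp8 hp7 hpq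
  have hns_14q_p : ¬ IsSquare (((14 * q : ℤ)) : ZMod p) :=
    (legendreSym.eq_neg_one_iff p).mp (by
      rw [show (14 * q : ℤ) = 2 * 7 * q by ring, legendreSym.mul, legendreSym.mul, h2p, h7p, hqp_p]; norm_num)
  have hns_m2q_p : ¬ IsSquare (((-2 * q : ℤ)) : ZMod p) :=
    (legendreSym.eq_neg_one_iff p).mp (by
      rw [show (-2 * q : ℤ) = -1 * 2 * q by ring, legendreSym.mul, legendreSym.mul, hm1p, h2p, hqp_p]; norm_num)
  have hns_m14_p : ¬ IsSquare (((-14 : ℤ)) : ZMod p) :=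
    (legendreSym.eq_neg_one_iff p).mp (by
      rw [show (-14 : ℤ) = -1 * 2 * 7 by ring, legendreSym.mul, legendreSym.mul, hm1p, h2p, h7p]; norm_num)
  have hns_2_p : ¬ IsSquare (((2 : ℤ)) : ZMod p) := (legendreSym.eq_neg_one_iff p).mp h2p
  have h14p0 : ((14 : ℤ) : ZMod p) ≠ 0 := by
    intro h; apply hns_14q_p
    rw [show ((14 * q : ℤ) : ZMod p) = ((14 : ℤ) : ZMod p) * q by push_cast; ring, h, zero_mul]; exact IsSquare.zero
  have h2q0 : ((2 * q : ℤ) : ZMod p) ≠ 0 := by push_cast; exact mul_ne_zero (by exact_mod_cast h2p0) (by exact_mod_cast hqp0)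
  -- `u² = 7` and `x⁴ = −7` mod `p`
  obtain ⟨u, hu⟩ : ∃ u : ZMod p, u ^ 2 = 7 := by
    have h7p0 : ((7 : ℤ) : ZMod p) ≠ 0 := by
      intro h; apply h448p; rw [show (448 : ZMod p) = ((7 : ℤ) : ZMod p) * 64 by push_cast; norm_num, h, zero_mul]
    obtain ⟨u, hu⟩ := (legendreSym.eq_one_iff p h7p0).mp h7p
    exact ⟨u, by rw [sq, ← hu]; push_cast; ring⟩
  obtain ⟨x, hx⟩ := hβ
  subst hde
  have hd'e : e * d' = -28 * (q : ℤ) ^ 2 * p := mul_left_cancel₀ hp0 (by linear_combination (-1 : ℤ) * hdd')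
  have h0 : (p : ℤ) * e ∣ -28 * ((q : ℤ) * p) ^ 2 := ⟨d', hdd'⟩
  have h1 : (p : ℤ) * e ∣ (14 * ((q : ℤ) * p)) ^ 2 := h0.trans ⟨-7, by ring⟩
  have h14qp : (p : ℤ) * e ∣ 14 * ((q : ℤ) * p) := (hsqf.dvd_pow_iff_dvd (by norm_num)).mp h1
  have he14q : e ∣ 14 * (q : ℤ) := by
    have : (p : ℤ) * e ∣ (p : ℤ) * (14 * q) := by rw [show (p : ℤ) * (14 * q) = 14 * (q * p) by ring]; exact h14qp
    exact (mul_dvd_mul_iff_left hp0).mp this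
  by_cases hqe : (q : ℤ) ∣ e
  · obtain ⟨e₂, rfl⟩ := hqe
    have he14 : e₂ ∣ 14 := by
      have : (q : ℤ) * e₂ ∣ (q : ℤ) * 14 := by rw [mul_comm (q : ℤ) 14]; exact he14q
      exact (mul_dvd_mul_iff_left hq0).mp this
    have hd'e₂ : e₂ * d' = -28 * (q : ℤ) * p := mul_left_cancel₀ hq0 (by linear_combination hd'e)
    have hele : e₂ ≤ 14 := Int.le_of_dvd (by norm_num) he14
    have hege : -14 ≤ e₂ := by have := Int.le_of_dvd (by norm_num) ((Int.neg_dvd).mpr he14); linarith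
    -- at `7`: `qp`, `2qp` (test `d`), `−7qp`, `−14qp` (test `d′`)
    have hne1 : e₂ ≠ 1 := by
      rintro rfl; exact not_isSoluble_seven_dual h7qp hdd'.symm (not_seven_dvd_mul_dualThreeFivePlus h7P (not_seven_dvd_mul_dualThreeFivePlus h7Q (by decide)))
        (by rw [legendreSym.mul, legendreSym.mul, h7_p, h7_q]; norm_num) (hpadic 7)
    have hne2 : e₂ ≠ 2 := by
      rintro rfl; exact not_isSoluble_seven_dual h7qp hdd'.symm (not_seven_dvd_mul_dualThreeFivePlus h7P (not_seven_dvd_mul_dualThreeFivePlus h7Q (by decide)))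
        (by rw [legendreSym.mul, legendreSym.mul, h7_p, h7_q]; norm_num) (hpadic 7)
    have hnem7 : e₂ ≠ -7 := by
      rintro rfl
      have hd'1 : d' = 4 * ((q : ℤ) * p) := mul_left_cancel₀ (by norm_num : (-7 : ℤ) ≠ 0) (by linear_combination hd'e₂)
      refine not_isSoluble_seven_dual' h7qp hdd'.symm ?_ ?_ (hpadic 7)
      · rw [hd'1]; exact not_seven_dvd_mul_dualThreeFivePlus (by decide) (not_seven_dvd_mul_dualThreeFivePlus h7Q h7P)
      · rw [hd'1, legendreSym.mul, legendreSym.mul, h7_q, h7_p]; norm_num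
    have hnem14 : e₂ ≠ -14 := by
      rintro rfl
      have hd'1 : d' = 2 * ((q : ℤ) * p) := mul_left_cancel₀ (by norm_num : (-14 : ℤ) ≠ 0) (by linear_combination hd'e₂)
      refine not_isSoluble_seven_dual' h7qp hdd'.symm ?_ ?_ (hpadic 7)
      · rw [hd'1]; exact not_seven_dvd_mul_dualThreeFivePlus (by decide) (not_seven_dvd_mul_dualThreeFivePlus h7Q h7P)
      · rw [hd'1, legendreSym.mul, legendreSym.mul, h7_q, h7_p]; norm_num
    -- at `2` (T0′): `−2qp`, `14qp`, `−qp`, `7qp`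
    have hnem2 : e₂ ≠ -2 := by
      rintro rfl; exact not_isSoluble_two_dual_negTwoQP_threeFive hq8 hp8 rfl (by ring)
        (mul_left_cancel₀ (by norm_num : (-2 : ℤ) ≠ 0) (by linear_combination hd'e₂)) (hpadic 2)
    have hne14 : e₂ ≠ 14 := by
      rintro rfl; exact not_isSoluble_two_dual_fourteenQP_threeFive hq8 hp8 rfl (by ring)
        (mul_left_cancel₀ (by norm_num : (14 : ℤ) ≠ 0) (by linear_combination hd'e₂)) (hpadic 2)
    -- at `p` by the type-β root test: `−qp` (non-residue `−14`), `7qp` (non-residue `2`)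
    have hnem1 : e₂ ≠ -1 := by
      rintro rfl
      have hd'1 : d' = p * (28 * q) := mul_left_cancel₀ (by norm_num : (-1 : ℤ) ≠ 0) (by linear_combination hd'e₂)
      refine not_isSoluble_padic_typeBeta_class_dual (q := q) h448p hx hu (e₀ := q * -1) (e'₀ := 28 * q) (by ring)
        (by push_cast; exact mul_ne_zero (by exact_mod_cast h28p0) (by exact_mod_cast hqp0)) ?_ (by ring) hd'1 (hpadic p)
      rw [show (-2 : ZMod p) * (q : ZMod p) * ((28 * q : ℤ) : ZMod p) = (((-14 * (2 * q) ^ 2 : ℤ)) : ZMod p) by push_cast; ring]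
      exact not_isSquare_mul_sq_zmod h2q0 hns_m14_p
    have hne7 : e₂ ≠ 7 := by
      rintro rfl
      have hd'1 : d' = p * (-4 * q) := mul_left_cancel₀ (by norm_num : (7 : ℤ) ≠ 0) (by linear_combination hd'e₂)
      refine not_isSoluble_padic_typeBeta_class_dual (q := q) h448p hx hu (e₀ := q * 7) (e'₀ := -4 * q) (by ring)
        (by push_cast; exact mul_ne_zero (neg_ne_zero.mpr (by exact_mod_cast h4p0)) (by exact_mod_cast hqp0)) ?_ (by ring) hd'1 (hpadic p)
      rw [show (-2 : ZMod p) * (q : ZMod p) * ((-4 * q : ℤ) : ZMod p) = (((2 * (2 * q) ^ 2 : ℤ)) : ZMod p) by push_cast; ring]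
      exact not_isSquare_mul_sq_zmod h2q0 hns_2_p
    -- nothing survives
    obtain ⟨k, hk⟩ := he14
    interval_cases e₂ <;> omega
  · -- `q ∤ e`: `e ∣ 14`; six die, `2p` and `−14p` survive
    have hcop : IsCoprime e (q : ℤ) := ((hqZ.irreducible.coprime_iff_not_dvd).mpr hqe).symm
    have he14 : e ∣ 14 := hcop.dvd_of_dvd_mul_left (by rw [mul_comm]; exact he14q)
    have hele : e ≤ 14 := Int.le_of_dvd (by norm_num) he14
    have hege : -14 ≤ e := by have := Int.le_of_dvd (by norm_num) ((Int.neg_dvd).mpr he14); linarith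
    -- at `7`: `−p`, `−2p` (test `d`), `7p`, `14p` (test `d′`)
    have hnem1 : e ≠ -1 := by
      rintro rfl; exact not_isSoluble_seven_dual h7qp hdd'.symm (not_seven_dvd_mul_dualThreeFivePlus h7P (by decide))
        (by rw [legendreSym.mul, h7_p]; norm_num) (hpadic 7)
    have hnem2 : e ≠ -2 := by
      rintro rfl; exact not_isSoluble_seven_dual h7qp hdd'.symm (not_seven_dvd_mul_dualThreeFivePlus h7P (by decide))
        (by rw [legendreSym.mul, h7_p]; norm_num) (hpadic 7)
    have hne7 : e ≠ 7 := by
      rintro rfl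
      have hd'1 : d' = -4 * ((q : ℤ) ^ 2 * p) := mul_left_cancel₀ (by norm_num : (7 : ℤ) ≠ 0) (by linear_combination hd'e)
      refine not_isSoluble_seven_dual' h7qp hdd'.symm ?_ ?_ (hpadic 7)
      · rw [hd'1]
        exact not_seven_dvd_mul_dualThreeFivePlus (by decide) (not_seven_dvd_mul_dualThreeFivePlus (by rw [sq]; exact not_seven_dvd_mul_dualThreeFivePlus h7Q h7Q) h7P)
      · rw [hd'1, legendreSym.mul, legendreSym.mul, legendreSym.sq_one' 7 hq07, h7_p]; norm_num
    have hne14 : e ≠ 14 := by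
      rintro rfl
      have hd'1 : d' = -2 * ((q : ℤ) ^ 2 * p) := mul_left_cancel₀ (by norm_num : (14 : ℤ) ≠ 0) (by linear_combination hd'e)
      refine not_isSoluble_seven_dual' h7qp hdd'.symm ?_ ?_ (hpadic 7)
      · rw [hd'1]
        exact not_seven_dvd_mul_dualThreeFivePlus (by decide) (not_seven_dvd_mul_dualThreeFivePlus (by rw [sq]; exact not_seven_dvd_mul_dualThreeFivePlus h7Q h7Q) h7P)
      · rw [hd'1, legendreSym.mul, legendreSym.mul, legendreSym.sq_one' 7 hq07, h7_p]; norm_num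
    -- at `p` by the type-β root test: `p`, `−7p`, `2p`, `−14p`
    have hne1 : e ≠ 1 := by
      rintro rfl
      have hd'1 : d' = p * (-28 * q ^ 2) := by linear_combination hd'e
      refine not_isSoluble_padic_typeBeta_class_dual (q := q) h448p hx hu (e₀ := 1) (e'₀ := -28 * q ^ 2) (by ring)
        (by push_cast; exact mul_ne_zero (neg_ne_zero.mpr (by exact_mod_cast h28p0)) (pow_ne_zero 2 (by exact_mod_cast hqp0))) ?_
        (by ring) hd'1 (hpadic p)
      rw [show (-2 : ZMod p) * (q : ZMod p) * ((-28 * q ^ 2 : ℤ) : ZMod p) = (((14 * q * (2 * q) ^ 2 : ℤ)) : ZMod p) by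
        push_cast; ring]
      exact not_isSquare_mul_sq_zmod h2q0 hns_14q_p
    have hnem7 : e ≠ -7 := by
      rintro rfl
      have hd'1 : d' = p * (4 * q ^ 2) := mul_left_cancel₀ (by norm_num : (-7 : ℤ) ≠ 0) (by linear_combination hd'e)
      refine not_isSoluble_padic_typeBeta_class_dual (q := q) h448p hx hu (e₀ := -7) (e'₀ := 4 * q ^ 2) (by ring)
        (by push_cast; exact mul_ne_zero (by exact_mod_cast h4p0) (pow_ne_zero 2 (by exact_mod_cast hqp0))) ?_ (by ring) hd'1 (hpadic p)
      rw [show (-2 : ZMod p) * (q : ZMod p) * ((4 * q ^ 2 : ℤ) : ZMod p) = (((-2 * q * (2 * q) ^ 2 : ℤ)) : ZMod p) by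
        push_cast; ring]
      exact not_isSquare_mul_sq_zmod h2q0 hns_m2q_p
    -- `2p`, `−14p` survive
    obtain ⟨k, hk⟩ := he14
    interval_cases e <;> omega

set_option maxHeartbeats 400000 in -- sixteen classes prime to `p`
/-- **§2. `S′ = S(84qp, −28q²p²) ⊆ {1, −7, 2, −14}`** on the β cell `q ≡ 3 (8)`, `p ≡ 1 (8)`, `(p/q) = −1`.
[cite: SilvermanAEC2009, Prop. X.4.9 and Example X.4.10] [cite: Zywina2025, Lemma 3.1 (proof)] -/
theorem twoIsogenySelmerGroup'_twoPrimesTwist_subset_threeModEightPlusPFive (hq8 : q % 8 = 3) (hq7 : jacobiSym q 7 = -1) (hp8 : p % 8 = 5)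
    (hp7 : legendreSym p (-7) = 1) (hβ : ∃ x : ZMod p, x ^ 4 = -7) (hpq : jacobiSym p q = 1) :
    twoIsogenySelmerGroup' (-42 * ((q : ℤ) * p)) (448 * ((q : ℤ) * p) ^ 2) ⊆ ({1, -7, 2 * (p : ℤ), -14 * (p : ℤ)} : Finset ℤ) := by
  have hq : q.Prime := Fact.out
  have hp : p.Prime := Fact.out
  haveI : Fact (Nat.Prime 7) := ⟨by norm_num⟩
  have hqZ : Prime (q : ℤ) := Nat.prime_iff_prime_int.mp hq
  have hpZ : Prime (p : ℤ) := Nat.prime_iff_prime_int.mp hp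
  have hq0 : (q : ℤ) ≠ 0 := by exact_mod_cast hq.ne_zero
  have hp0 : (p : ℤ) ≠ 0 := by exact_mod_cast hp.ne_zero
  obtain ⟨⟨-, h7qp, h7Q, h7P⟩, ⟨h7_q, h7_p, hq07, hp07⟩, ⟨h2p, h7p, hm1p, hqp_p⟩, ⟨hqp0, h2p0, -, -, -⟩⟩ :=
    dual_facts_threeFivePlus hq8 hq7 hp8 hp7 hpq
  have hns_2_p : ¬ IsSquare (((2 : ℤ)) : ZMod p) := (legendreSym.eq_neg_one_iff p).mp h2p
  have hns_m14_p : ¬ IsSquare (((-14 : ℤ)) : ZMod p) :=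
    (legendreSym.eq_neg_one_iff p).mp (by
      rw [show (-14 : ℤ) = -1 * 2 * 7 by ring, legendreSym.mul, legendreSym.mul, hm1p, h2p, h7p]; norm_num)
  have hns_m14qq_p : ¬ IsSquare (((-14 * q ^ 2 : ℤ)) : ZMod p) := not_isSquare_mul_sq_zmod (by exact_mod_cast hqp0) hns_m14_p
  have hns_2qq_p : ¬ IsSquare (((2 * q ^ 2 : ℤ)) : ZMod p) := not_isSquare_mul_sq_zmod (by exact_mod_cast hqp0) hns_2_p
  have hns_qm2_p : ¬ IsSquare ((((q : ℤ) * -2 : ℤ)) : ZMod p) :=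
    (legendreSym.eq_neg_one_iff p).mp (by
      rw [show ((q : ℤ) * -2 : ℤ) = q * -1 * 2 by ring, legendreSym.mul, legendreSym.mul, hqp_p, hm1p, h2p]; norm_num)
  have hns_q14_p : ¬ IsSquare ((((q : ℤ) * 14 : ℤ)) : ZMod p) :=
    (legendreSym.eq_neg_one_iff p).mp (by
      rw [show ((q : ℤ) * 14 : ℤ) = q * 2 * 7 by ring, legendreSym.mul, legendreSym.mul, hqp_p, h2p, h7p]; norm_num)
  have hns_14q_p : ¬ IsSquare (((14 * q : ℤ)) : ZMod p) := by rw [show (14 * q : ℤ) = q * 14 by ring]; exact hns_q14_p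
  have hns_m2q_p : ¬ IsSquare (((-2 * q : ℤ)) : ZMod p) := by rw [show (-2 * q : ℤ) = q * -2 by ring]; exact hns_qm2_p
  have hA : (-2 * (-42 * ((q : ℤ) * p))) = 84 * ((q : ℤ) * p) := by ring
  have hB : ((-42 * ((q : ℤ) * p)) ^ 2 - 4 * (448 * ((q : ℤ) * p) ^ 2)) = -28 * ((q : ℤ) * p) ^ 2 := by ring
  have hb : (-28 * ((q : ℤ) * p) ^ 2 : ℤ) ≠ 0 := mul_ne_zero (by norm_num) (pow_ne_zero 2 (mul_ne_zero hq0 hp0))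
  intro d hd
  rw [twoIsogenySelmerGroup'_eq, hA, hB, mem_twoIsogenySelmerGroup_iff hb] at hd
  obtain ⟨hsqf, ⟨d', hdd'⟩, hloc⟩ := hd
  have hd'eq : (-28 * ((q : ℤ) * p) ^ 2 : ℤ) / d = d' := by rw [hdd', Int.mul_ediv_cancel_left _ hsqf.ne_zero]
  rw [hd'eq] at hloc
  obtain ⟨-, hpadic⟩ := hloc
  simp only [Finset.mem_insert, Finset.mem_singleton]
  by_cases hpd : (p : ℤ) ∣ d
  · -- `p ∣ d`: only `2p`, `−14p` survive (§1)
    rcases eq_of_prime_dvd_of_mem_twoIsogenySelmerGroup'_twoPrimesTwist_threeModEightPlusPFive hq8 hq7 hp8 hp7 hβ hpq hsqf hdd' hpadic hpd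
      with h | h
    · exact Or.inr (Or.inr (Or.inl h))
    · exact Or.inr (Or.inr (Or.inr h))
  · have h0 : d ∣ -28 * ((q : ℤ) * p) ^ 2 := ⟨d', hdd'⟩
    have h1 : d ∣ (14 * ((q : ℤ) * p)) ^ 2 := h0.trans ⟨-7, by ring⟩
    have h14qp : d ∣ 14 * ((q : ℤ) * p) := (hsqf.dvd_pow_iff_dvd (by norm_num)).mp h1
    have hcopp : IsCoprime d (p : ℤ) := ((hpZ.irreducible.coprime_iff_not_dvd).mpr hpd).symm
    have h14q : d ∣ 14 * (q : ℤ) := hcopp.dvd_of_dvd_mul_right (by rw [show 14 * (q : ℤ) * p = 14 * (q * p) by ring]; exact h14qp)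
    by_cases hqd : (q : ℤ) ∣ d
    · -- `d = q·e`, `e ∣ 14`: all eight die
      exfalso
      obtain ⟨e, rfl⟩ := hqd
      have he14 : e ∣ 14 := by
        have : (q : ℤ) * e ∣ (q : ℤ) * 14 := by rw [mul_comm (q : ℤ) 14]; exact h14q
        exact (mul_dvd_mul_iff_left hq0).mp this
      have hd'e : e * d' = -28 * (q : ℤ) * p ^ 2 := mul_left_cancel₀ hq0 (by linear_combination (-1 : ℤ) * hdd')
      have hele : e ≤ 14 := Int.le_of_dvd (by norm_num) he14
      have hege : -14 ≤ e := by have := Int.le_of_dvd (by norm_num) ((Int.neg_dvd).mpr he14); linarith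
      -- at `7`: `q`, `2q` (test `d`), `−7q`, `−14q` (test `d′`)
      have hne1 : e ≠ 1 := by
        rintro rfl; exact not_isSoluble_seven_dual h7qp hdd'.symm (not_seven_dvd_mul_dualThreeFivePlus h7Q (by decide))
          (by rw [legendreSym.mul, h7_q]; norm_num) (hpadic 7)
      have hne2 : e ≠ 2 := by
        rintro rfl; exact not_isSoluble_seven_dual h7qp hdd'.symm (not_seven_dvd_mul_dualThreeFivePlus h7Q (by decide))
          (by rw [legendreSym.mul, h7_q]; norm_num) (hpadic 7)
      have hnem7 : e ≠ -7 := by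
        rintro rfl
        have hd'1 : d' = 4 * ((q : ℤ) * (p : ℤ) ^ 2) := mul_left_cancel₀ (by norm_num : (-7 : ℤ) ≠ 0) (by linear_combination hd'e)
        refine not_isSoluble_seven_dual' h7qp hdd'.symm ?_ ?_ (hpadic 7)
        · rw [hd'1]
          exact not_seven_dvd_mul_dualThreeFivePlus (by decide) (not_seven_dvd_mul_dualThreeFivePlus h7Q (by rw [sq]; exact not_seven_dvd_mul_dualThreeFivePlus h7P h7P))
        · rw [hd'1, legendreSym.mul, legendreSym.mul, legendreSym.sq_one' 7 hp07, h7_q]; norm_num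
      have hnem14 : e ≠ -14 := by
        rintro rfl
        have hd'1 : d' = 2 * ((q : ℤ) * (p : ℤ) ^ 2) := mul_left_cancel₀ (by norm_num : (-14 : ℤ) ≠ 0) (by linear_combination hd'e)
        refine not_isSoluble_seven_dual' h7qp hdd'.symm ?_ ?_ (hpadic 7)
        · rw [hd'1]
          exact not_seven_dvd_mul_dualThreeFivePlus (by decide) (not_seven_dvd_mul_dualThreeFivePlus h7Q (by rw [sq]; exact not_seven_dvd_mul_dualThreeFivePlus h7P h7P))
        · rw [hd'1, legendreSym.mul, legendreSym.mul, legendreSym.sq_one' 7 hp07, h7_q]; norm_num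
      -- at `2` (Fβ⁺-0c): `−q`, `7q`; at `p` by non-residue: `−2q`, `14q`
      have hnem1 : e ≠ -1 := by
        rintro rfl; exact not_isSoluble_two_dual_negQ_threeFive hq8 hp8 rfl (by ring)
          (by linear_combination (-1 : ℤ) * hd'e) (hpadic 2)
      have hne7 : e ≠ 7 := by
        rintro rfl; exact not_isSoluble_two_dual_sevenQ_threeFive hq8 hp8 rfl (by ring)
          (mul_left_cancel₀ (by norm_num : (7 : ℤ) ≠ 0) (by linear_combination hd'e)) (hpadic 2)
      have hnem2 : e ≠ -2 := by
        rintro rfl; exact not_isSoluble_padic_of_nonresidue_of_sq_dvd (p := p) (c := 84 * q) (e' := 14 * q) (by ring)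
          (mul_left_cancel₀ (by norm_num : (-2 : ℤ) ≠ 0) (by linear_combination hd'e)) hns_qm2_p hns_14q_p (hpadic p)
      have hne14 : e ≠ 14 := by
        rintro rfl; exact not_isSoluble_padic_of_nonresidue_of_sq_dvd (p := p) (c := 84 * q) (e' := -2 * q) (by ring)
          (mul_left_cancel₀ (by norm_num : (14 : ℤ) ≠ 0) (by linear_combination hd'e)) hns_q14_p hns_m2q_p (hpadic p)
      obtain ⟨k, hk⟩ := he14
      interval_cases e <;> omega
    · have hcop : IsCoprime d (q : ℤ) := ((hqZ.irreducible.coprime_iff_not_dvd).mpr hqd).symm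
      have hd14 : d ∣ 14 := hcop.dvd_of_dvd_mul_right h14q
      have hle : d ≤ 14 := Int.le_of_dvd (by norm_num) hd14
      have hge : -14 ≤ d := by have := Int.le_of_dvd (by norm_num) ((Int.neg_dvd).mpr hd14); linarith
      -- at `7`: `−1`, `−2` (test `d`), `7`, `14` (test `d′`)
      have hnm1 : d ≠ -1 := by
        rintro rfl; exact not_isSoluble_seven_dual h7qp hdd'.symm (by decide) (by norm_num) (hpadic 7)
      have hnm2 : d ≠ -2 := by
        rintro rfl; exact not_isSoluble_seven_dual h7qp hdd'.symm (by decide) (by norm_num) (hpadic 7)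
      have h7QP : ¬ (7 : ℤ) ∣ ((q : ℤ) * p) ^ 2 := by
        rw [sq]; exact not_seven_dvd_mul_dualThreeFivePlus (not_seven_dvd_mul_dualThreeFivePlus h7Q h7P) (not_seven_dvd_mul_dualThreeFivePlus h7Q h7P)
      have hQP07 : ((((q : ℤ) * p : ℤ)) : ZMod 7) ≠ 0 := by push_cast at hq07 hp07 ⊢; exact mul_ne_zero hq07 hp07
      have hn7 : d ≠ 7 := by
        rintro rfl
        have hd'1 : d' = -4 * ((q : ℤ) * p) ^ 2 := by linarith
        refine not_isSoluble_seven_dual' h7qp hdd'.symm ?_ ?_ (hpadic 7)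
        · rw [hd'1]; exact not_seven_dvd_mul_dualThreeFivePlus (by decide) h7QP
        · rw [hd'1, legendreSym.mul, legendreSym.sq_one' 7 hQP07]; norm_num
      have hn14 : d ≠ 14 := by
        rintro rfl
        have hd'1 : d' = -2 * ((q : ℤ) * p) ^ 2 := by linarith
        refine not_isSoluble_seven_dual' h7qp hdd'.symm ?_ ?_ (hpadic 7)
        · rw [hd'1]; exact not_seven_dvd_mul_dualThreeFivePlus (by decide) h7QP
        · rw [hd'1, legendreSym.mul, legendreSym.sq_one' 7 hQP07]; norm_num
      -- at `p` by non-residue (`(2/p) = −1`): `2`, `−14`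
      have hn2 : d ≠ 2 := by
        rintro rfl; exact not_isSoluble_padic_of_nonresidue_of_sq_dvd (p := p) (c := 84 * q) (e' := -14 * q ^ 2) (by ring)
          (show d' = (p : ℤ) ^ 2 * (-14 * q ^ 2) by linarith) hns_2_p hns_m14qq_p (hpadic p)
      have hnm14 : d ≠ -14 := by
        rintro rfl; exact not_isSoluble_padic_of_nonresidue_of_sq_dvd (p := p) (c := 84 * q) (e' := 2 * q ^ 2) (by ring)
          (show d' = (p : ℤ) ^ 2 * (2 * q ^ 2) by linarith) hns_m14_p hns_2qq_p (hpadic p)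
      -- `1`, `−7` survive
      obtain ⟨k, hk⟩ := hd14
      interval_cases d <;> first | (exfalso; omega) | simp

/-- **`#S′ = #S(84qp, −28q²p²) ≤ 4`** on the β cell `q ≡ 3 (8)`, `p ≡ 5 (8)`, `(p/q) = +1` (sharp by the kit).
[cite: SilvermanAEC2009, Prop. X.4.9 and Example X.4.10] -/
theorem card_twoIsogenySelmerGroup'_twoPrimesTwist_le_four_threeModEightPlusPFive (hq8 : q % 8 = 3) (hq7 : jacobiSym q 7 = -1)
    (hp8 : p % 8 = 5) (hp7 : legendreSym p (-7) = 1) (hβ : ∃ x : ZMod p, x ^ 4 = -7) (hpq : jacobiSym p q = 1) :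
    (twoIsogenySelmerGroup' (-42 * ((q : ℤ) * p)) (448 * ((q : ℤ) * p) ^ 2)).card ≤ 4 :=
  (Finset.card_le_card (twoIsogenySelmerGroup'_twoPrimesTwist_subset_threeModEightPlusPFive hq8 hq7 hp8 hp7 hβ hpq)).trans Finset.card_le_four

end SelmerDualThreeFivePlus

end Summit.BirchSwinnertonDyer.BirchSwinnertonDyer.Theorems.GoldfeldGoodTwists

end
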